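import Summits.QuantumFields.BalabanUV.Gaps.D1WardPinsBorderWeight
import Summits.QuantumFields.BalabanUV.Gaps.D1PinnedColourRayQuartic
import Summits.QuantumFields.BalabanUV.Beta.GAN24.EvenTowerAutonomy

/-!
# `BalabanUV.Gaps.D1RecordWardPinsBorderWeight` — cell pub-balaban-gaps, row (D1), seat g1-p1: THE RECORD-LITERAL TWIN of `Gaps/D1WardPinsBorderWeight` — leaf-05's slotted recursive
# second-order tables `T2RecOf G S M cE₂ cB T vh₂S mixFF` are AFFINE IN THE BORDER WEIGHT `cB` (any slots, under the displayed letters), hence so are, ENTRYWISE, the step kernels of the b2b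
# wall's chart-(III′) literal `JsB12CombShSym hLc N tabs cΛ cB`; so at the literal of record the Ward binder `hW` (and the reflection binder `hR`) at one level PINS `cB` wherever the
# unit border tower has a nonzero zeroth (resp. first) moment — and by value (RESULT-1) `hW♭`, `hR♭` DO hold at the record's `cB = −Lc¹²∕4` at level 0

HONEST FRAMING (cell rule, page 1 of everything): [folklore] kernel algebra BY NAME — leaf-05's `RecursiveWSlot` (`T2RecOf`, `WrecOf`, `T2RecOf_succ`, `T2RecOf_loc`, `vertexFamily₂_WrecOf'`),
gan24's `EvenTowerAutonomy.e4OfKW_add_carrier` (the read-out is affine in the carrier), `T2RecursionAffine.W2SymOfK_eq_add_vsym`, `Lin4Additive.vsym_smul`, GEN 12's `vsym_sub` ∕ `hessKer_sub_W` ∕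
`loc_vsym`, an2's `CombChartStepJets` (`decays_GcombSh`, `locStencil_SpureCombOf`, `vertexFamily₂_WcombOf`, `WcombOf_eq`) and `CombChartJointEnd.TbalOf_JsB12CombShSym`, GEN 15's
`D1WardPinsBorderWeight` (`zerothMoment_affine`, `firstMoment_affine`, `eq_zero_of_affine_pair`), an1's `tsum_eq_zero_of_ward` ∕ `firstMoment_eq_zero_of_reflectionCovariant`.  `hW`∕`hR` are HYPOTHESES
about members of the b2b wall's (III′) family; the only number mentioned (RESULT-1's by-value hW♭∕hR♭ at the record's `cB`, level 0, p = 3) is a float reading of ZERO weight, in docstrings only.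
Nothing of Bałaban's asserted; NO coefficient computed or signed; (D1) NOT discharged; 0∕4 row-D1 binders; NOT `BetaPertH`, NOT continuum, NOT Clay.
HONEST DEPENDENCY (b2b cell, verbatim): «continuum YM on T⁴ ⇐ BetaPertH ∧ nine spine estimates (0/9 proved); BetaPertH ⇐ (D1) ∧ (D4) ∧ CAP+tail; G-an2-4 gates asym, D1 and NE2/3/4.»

CONTENT (all [folklore]; no `def`, 0 sorry): §1 GENERIC SLOTS — `WrecOf_eq_add_vsym`, **`T2RecOf_border_affine`** (`T2RecOf … cB … j − T2RecOf … 0 … j = cB • (T2RecOf … 1 … j − T2RecOf … 0 … j)`,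
every level, under (DG)(LS)(LM) + `hB`∕`hmix`, `1 ≤ Lc`), `WrecOf_border_affine`; §2 THE (III′) LITERAL — **`TbalOf_JsB12CombShSym_border_affine`** (ENTRYWISE `T_j(cB) = T_j(0) + cB·(T_j(1) − T_j(0))`),
`zerothMoment_∕firstMoment_flipK_TbalOf_JsB12CombShSym_border_affine`; §3 **`record_borderWeight_eq_of_ward`**, **`record_borderWeight_unique_of_ward`**, `record_borderWeight_formula_of_ward`,
**`record_borderWeight_unique_of_hR`**.

Provenance: cell pub-balaban-gaps, seat g1-p1 GEN 15 (prover-pub-balaban-gaps-g1-p1-g15-0), 2026-08-25; no existing file touched.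
-/

noncomputable section

open Literature.MathematicalPhysics.QuantumFieldTheory Balaban1983to89 Balaban1983to89.Beta Filter Topology
open ExpKernelCalculus (MKer Decays VertexFamily VertexFamily₂ hessKer tadpole comp)
open BalabanStepJetsSucc (mmRead)
open OneStepResolventKernel (Fib LocStencil JetData)
open OneStepKernelFamily (TbalOf flipK)
open PolarizationSign (WardTransversal AxisReflectionCovariant MomentSummable tsum_eq_zero_of_ward)
open OddMoments (zerothMoment firstMoment firstMoment_eq_zero_of_reflectionCovariant)
open BalabanCompositeJets (LocStencil₂)
open SecondOrderResponse (W2SymOfK LocStencilFM)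
open BalabanStepW2 (M2Of wV4 wB2 locStencil₂_smul' locStencil₂_add')
open Summit.QuantumFields.BalabanUV.Beta.TameKernelCalculus (Spr Loc)
open Summit.QuantumFields.BalabanUV.Beta.SpineRooted (e4OfKW T2RecOf WrecOf T2RecOf_zero_level T2RecOf_succ WrecOf_eq T2RecOf_loc vertexFamily₂_WrecOf')
open Summit.QuantumFields.BalabanUV.Beta.GAN24.T2RecursionAffine (vsym W2SymOfK_eq_add_vsym)
open Summit.QuantumFields.BalabanUV.Beta.GAN24.Lin4Additive (vsym_smul)
open Summit.QuantumFields.BalabanUV.Beta.GAN24.ThirdJetKernel (mmRead_smul)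
open Summit.QuantumFields.BalabanUV.Beta.GAN24.EvenTowerAutonomy (e4OfKW_add_carrier)
open Summit.QuantumFields.BalabanUV.Beta.SecondOrderRemainderTables (abs_le_of_locStencil₂)
open Summit.QuantumFields.BalabanUV.Beta.SymmetrisedStepJets (SymTables)
open Summit.QuantumFields.BalabanUV.Beta.CombChartStepJets (GcombSh decays_GcombSh SpureCombOf WcombOf WcombOf_eq locStencil_SpureCombOf vertexFamily₂_WcombOf JsB12CombSh0
  JsB12CombSh0_eq JsComb0Of_S JsComb0Of_W)
open Summit.QuantumFields.BalabanUV.Beta.CombChartJointEnd (JsB12CombShSym TbalOf_JsB12CombShSym)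
open Summit.QuantumFields.BalabanUV.Gaps.D1PinnedResponseTowers (vsym_sub hessKer_sub_W)
open Summit.QuantumFields.BalabanUV.Gaps.D1PinnedColourRayQuartic (loc_vsym)
open Summit.QuantumFields.BalabanUV.Gaps.D1IndexSymmetryDictionary (momentSummable_flipK_TbalOf)
open Summit.QuantumFields.BalabanUV.Gaps.D1WardPinsBorderWeight (zerothMoment_affine firstMoment_affine eq_zero_of_affine_pair)

namespace Summit.QuantumFields.BalabanUV.Gaps.D1RecordWardPinsBorderWeight

/-! ## §1 The slotted recursive tower is affine in the border weight -/

section Slots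

variable {d Lc : ℕ} [NeZero Lc]
variable {G : ℕ → MKer (d + 1) (Fib d)} {S M : ℕ → Fin (d + 1) → (Fin (d + 1) → ℤ) → MKer (d + 1) (Fib d)} (cE₂ : ℝ)
  (T : Fin 4 → Fin 4 → Fin 4 → Fin 4 → ℝ) {vh₂S mixFF : Fin (d + 1) → (Fin (d + 1) → ℤ) → Fin (d + 1) → (Fin (d + 1) → ℤ) → MKer (d + 1) (Fib d)}

/-- [folklore] The W-slot tables of two border weights differ by `vsym` of the tower difference (gan24's `W2SymOfK_eq_add_vsym` + GEN 12's `vsym_sub` on the certified members). -/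
theorem WrecOf_sub (hLc : 1 ≤ Lc) (hG : ∀ j : ℕ, ∃ δ C : ℝ, 0 < δ ∧ 0 ≤ C ∧ Decays (G j) C δ)
    (hS : ∀ j : ℕ, ∃ Cs δ : ℝ, 0 < δ ∧ LocStencil (S j) Cs δ) (hM : ∀ j : ℕ, ∃ CM δ : ℝ, 0 < δ ∧ VertexFamily (M j) Lc CM δ)
    (hB : ∃ C δ : ℝ, 0 < δ ∧ LocStencil₂ vh₂S C δ) (hmix : ∃ C δ : ℝ, 0 < δ ∧ LocStencilFM Lc mixFF C δ) (cB cB' : ℝ) (j : ℕ)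
    (κ : Fin (d + 1)) (u : Fin (d + 1) → ℤ) (κ' : Fin (d + 1)) (u' : Fin (d + 1) → ℤ) :
    WrecOf d Lc G S M cE₂ cB T vh₂S mixFF j κ u κ' u' - WrecOf d Lc G S M cE₂ cB' T vh₂S mixFF j κ u κ' u' =
      vsym (G j) Lc (T2RecOf d Lc G S M cE₂ cB T vh₂S mixFF j - T2RecOf d Lc G S M cE₂ cB' T vh₂S mixFF j) κ u κ' u' := by
  obtain ⟨δK, CK, hδK, -, hK⟩ := hG j
  obtain ⟨C₁, δ₁, hδ₁, h₁⟩ := T2RecOf_loc cE₂ cB T vh₂S mixFF hLc hG hS hM hB hmix j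
  obtain ⟨C₀, δ₀, hδ₀, h₀⟩ := T2RecOf_loc cE₂ cB' T vh₂S mixFF hLc hG hS hM hB hmix j
  have hC₁ : 0 ≤ C₁ := (abs_nonneg _).trans (abs_le_of_locStencil₂ h₁ hδ₁.le 0 0 0 0 0 0 (Sum.inl 0) (Sum.inl 0))
  have hC₀ : 0 ≤ C₀ := (abs_nonneg _).trans (abs_le_of_locStencil₂ h₀ hδ₀.le 0 0 0 0 0 0 (Sum.inl 0) (Sum.inl 0))
  have bd₁ : ∀ κ u κ' u' x z a b, |T2RecOf d Lc G S M cE₂ cB T vh₂S mixFF j κ u κ' u' x z a b| ≤ C₁ + C₀ :=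
    fun κ u κ' u' x z a b => (abs_le_of_locStencil₂ h₁ hδ₁.le κ u κ' u' x z a b).trans (by linarith)
  have bd₀ : ∀ κ u κ' u' x z a b, |T2RecOf d Lc G S M cE₂ cB' T vh₂S mixFF j κ u κ' u' x z a b| ≤ C₁ + C₀ :=
    fun κ u κ' u' x z a b => (abs_le_of_locStencil₂ h₀ hδ₀.le κ u κ' u' x z a b).trans (by linarith)
  have e₁ := congrArg (fun F => F κ u κ' u') (W2SymOfK_eq_add_vsym (G j) Lc (S j) (M j) (T2RecOf d Lc G S M cE₂ cB T vh₂S mixFF j) (M2Of d Lc mixFF j))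
  have e₀ := congrArg (fun F => F κ u κ' u') (W2SymOfK_eq_add_vsym (G j) Lc (S j) (M j) (T2RecOf d Lc G S M cE₂ cB' T vh₂S mixFF j) (M2Of d Lc mixFF j))
  simp only [Pi.add_apply] at e₁ e₀
  rw [WrecOf_eq, WrecOf_eq, e₁, e₀, vsym_sub hK hδK Lc bd₁ bd₀ κ u κ' u']
  abel

/-- [folklore] **THE SLOTTED RECURSIVE TOWER IS AFFINE IN THE BORDER WEIGHT** (any slots `G, S, M`, any `cE₂`, `T`, binder tables; letters (DG)(LS)(LM), `hB`, `hmix`, `1 ≤ Lc`; every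
level): `T2RecOf … cB … j − T2RecOf … 0 … j = cB • (T2RecOf … 1 … j − T2RecOf … 0 … j)` — induction; the step: `WrecOf_sub`, `vsym_smul`, gan24's `e4OfKW_add_carrier` (the read-out is affine in
the carrier), `comp_smul_*`, `mmRead_smul`. -/
theorem T2RecOf_border_affine (hLc : 1 ≤ Lc) (hG : ∀ j : ℕ, ∃ δ C : ℝ, 0 < δ ∧ 0 ≤ C ∧ Decays (G j) C δ)
    (hS : ∀ j : ℕ, ∃ Cs δ : ℝ, 0 < δ ∧ LocStencil (S j) Cs δ) (hM : ∀ j : ℕ, ∃ CM δ : ℝ, 0 < δ ∧ VertexFamily (M j) Lc CM δ)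
    (hB : ∃ C δ : ℝ, 0 < δ ∧ LocStencil₂ vh₂S C δ) (hmix : ∃ C δ : ℝ, 0 < δ ∧ LocStencilFM Lc mixFF C δ) :
    ∀ (j : ℕ) (cB : ℝ), T2RecOf d Lc G S M cE₂ cB T vh₂S mixFF j - T2RecOf d Lc G S M cE₂ 0 T vh₂S mixFF j =
      cB • (T2RecOf d Lc G S M cE₂ 1 T vh₂S mixFF j - T2RecOf d Lc G S M cE₂ 0 T vh₂S mixFF j)
  | 0, cB => by
    funext κ u κ' u'
    simp only [T2RecOf_zero_level, Pi.sub_apply, Pi.smul_apply]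
    funext x z a b
    simp only [Pi.add_apply, Pi.sub_apply, Pi.smul_apply, smul_eq_mul]
    ring
  | j + 1, cB => by
    have IH := T2RecOf_border_affine hLc hG hS hM hB hmix j
    -- the W-slot tables of `cB''` and `0` differ by `cB'' • vsym (G j) Lc U_j`, `U_j` the unit tower at level `j`
    have hU : ∃ C δ : ℝ, 0 < δ ∧ LocStencil₂ (T2RecOf d Lc G S M cE₂ 1 T vh₂S mixFF j - T2RecOf d Lc G S M cE₂ 0 T vh₂S mixFF j) C δ := by
      obtain ⟨C₁, δ₁, hδ₁, h₁⟩ := T2RecOf_loc cE₂ (1 : ℝ) T vh₂S mixFF hLc hG hS hM hB hmix j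
      obtain ⟨C₀, δ₀, hδ₀, h₀⟩ := T2RecOf_loc cE₂ (0 : ℝ) T vh₂S mixFF hLc hG hS hM hB hmix j
      have h := locStencil₂_add' (h₁.mono (min_le_left δ₁ δ₀)) (locStencil₂_smul' (-1 : ℝ) (h₀.mono (min_le_right δ₁ δ₀)))
      have e : (T2RecOf d Lc G S M cE₂ 1 T vh₂S mixFF j - T2RecOf d Lc G S M cE₂ 0 T vh₂S mixFF j) =
          fun κ u κ' u' => T2RecOf d Lc G S M cE₂ 1 T vh₂S mixFF j κ u κ' u' + (-1 : ℝ) • T2RecOf d Lc G S M cE₂ 0 T vh₂S mixFF j κ u κ' u' := by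
        funext κ u κ' u'
        simp only [Pi.sub_apply, neg_one_smul, sub_eq_add_neg]
      rw [e]
      exact ⟨_, _, lt_min hδ₁ hδ₀, h⟩
    have hW : ∀ cB'' : ℝ, WrecOf d Lc G S M cE₂ cB'' T vh₂S mixFF j = WrecOf d Lc G S M cE₂ 0 T vh₂S mixFF j +
        cB'' • (fun κ u κ' u' => vsym (G j) Lc (T2RecOf d Lc G S M cE₂ 1 T vh₂S mixFF j - T2RecOf d Lc G S M cE₂ 0 T vh₂S mixFF j) κ u κ' u') := by
      intro cB''
      funext κ u κ' u'
      have h := WrecOf_sub cE₂ T hLc hG hS hM hB hmix cB'' 0 j κ u κ' u'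
      rw [IH cB'', vsym_smul] at h
      simp only [Pi.add_apply, Pi.smul_apply]
      rw [← h]
      abel
    obtain ⟨δK, CK, hδK, -, hK⟩ := hG j
    have hGs : Spr (G j) := ⟨CK, δK, hδK, hK⟩
    obtain ⟨Cw, δw, hδw, hWl⟩ := vertexFamily₂_WrecOf' cE₂ (0 : ℝ) T vh₂S mixFF hLc hG hS hM hB hmix j
    -- the read-out is affine in the carrier (gan24), so the step's value-4-jet read-outs differ by `cB'' •` ONE sandwich
    have hstep : ∀ (cB'' : ℝ) (κ : Fin (d + 1)) (u : Fin (d + 1) → ℤ) (κ' : Fin (d + 1)) (u' : Fin (d + 1) → ℤ),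
        e4OfKW Lc (G j) (S j) (M j) (WrecOf d Lc G S M cE₂ cB'' T vh₂S mixFF j) κ u κ' u' =
          e4OfKW Lc (G j) (S j) (M j) (WrecOf d Lc G S M cE₂ 0 T vh₂S mixFF j) κ u κ' u' -
            cB'' • mmRead Lc (comp (comp (G j) (vsym (G j) Lc (T2RecOf d Lc G S M cE₂ 1 T vh₂S mixFF j - T2RecOf d Lc G S M cE₂ 0 T vh₂S mixFF j) κ u κ' u')) (G j)) := by
      intro cB'' κ u κ' u'
      have hLW : Loc (WrecOf d Lc G S M cE₂ 0 T vh₂S mixFF j κ u κ' u') := ⟨_, _, _, _, hδw, hWl κ u κ' u'⟩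
      have hLX : Loc ((cB'' • fun κ u κ' u' => vsym (G j) Lc (T2RecOf d Lc G S M cE₂ 1 T vh₂S mixFF j - T2RecOf d Lc G S M cE₂ 0 T vh₂S mixFF j) κ u κ' u') κ u κ' u') := by
        simp only [Pi.smul_apply]
        exact (loc_vsym (hG j) _ hU κ u κ' u').smul cB''
      rw [hW cB'', e4OfKW_add_carrier Lc hGs (S j) (M j) κ u κ' u' hLW hLX]
      simp only [Pi.smul_apply]
      rw [KernelReflection.comp_smul_right, KernelReflection.comp_smul_left, mmRead_smul]
    funext κ u κ' u'
    simp only [T2RecOf_succ, Pi.sub_apply, Pi.smul_apply]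
    rw [hstep cB κ u κ' u', hstep 1 κ u κ' u']
    funext x z a b
    simp only [Pi.add_apply, Pi.sub_apply, Pi.smul_apply, smul_eq_mul]
    ring

/-- [folklore] … hence the W-SLOT TABLES are affine in the border weight entrywise: `WrecOf … cB … j b − WrecOf … 0 … j b = cB • (WrecOf … 1 … j b − WrecOf … 0 … j b)`. -/
theorem WrecOf_border_affine (hLc : 1 ≤ Lc) (hG : ∀ j : ℕ, ∃ δ C : ℝ, 0 < δ ∧ 0 ≤ C ∧ Decays (G j) C δ)
    (hS : ∀ j : ℕ, ∃ Cs δ : ℝ, 0 < δ ∧ LocStencil (S j) Cs δ) (hM : ∀ j : ℕ, ∃ CM δ : ℝ, 0 < δ ∧ VertexFamily (M j) Lc CM δ)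
    (hB : ∃ C δ : ℝ, 0 < δ ∧ LocStencil₂ vh₂S C δ) (hmix : ∃ C δ : ℝ, 0 < δ ∧ LocStencilFM Lc mixFF C δ) (cB : ℝ) (j : ℕ)
    (κ : Fin (d + 1)) (u : Fin (d + 1) → ℤ) (κ' : Fin (d + 1)) (u' : Fin (d + 1) → ℤ) :
    WrecOf d Lc G S M cE₂ cB T vh₂S mixFF j κ u κ' u' - WrecOf d Lc G S M cE₂ 0 T vh₂S mixFF j κ u κ' u' =
      cB • (WrecOf d Lc G S M cE₂ 1 T vh₂S mixFF j κ u κ' u' - WrecOf d Lc G S M cE₂ 0 T vh₂S mixFF j κ u κ' u') := by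
  rw [WrecOf_sub cE₂ T hLc hG hS hM hB hmix cB 0 j κ u κ' u', WrecOf_sub cE₂ T hLc hG hS hM hB hmix 1 0 j κ u κ' u',
    T2RecOf_border_affine cE₂ T hLc hG hS hM hB hmix j cB, vsym_smul]

end Slots

/-! ## §2 The b2b wall's chart-(III′) literal: step kernels affine in the border weight, ENTRYWISE -/

section Record

variable {Lc : ℕ} [NeZero Lc]

/-- [folklore] **THE (III′) LITERAL's STEP KERNELS ARE AFFINE IN `cB`, ENTRY BY ENTRY** (every table record `tabs`, table numeral `N`, `cΛ`, level, indices, site):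
`T_j(cB) μ ν z = T_j(0) μ ν z + cB·(T_j(1) μ ν z − T_j(0) μ ν z)` — an2's `TbalOf_JsB12CombShSym` (`= hessKer G′_j (vertexOfK G′_j Lc S⁰_j) W⁰_j(cB)` with `cB`-free first-order data), GEN 12's
`hessKer_sub_W`, §1's `WrecOf_border_affine` at the record's certified slots (`decays_GcombSh`, `locStencil_SpureCombOf`, `tabs.hM`, `tabs.hB`, `tabs.hmix`), `tadpole_smul`. -/
theorem TbalOf_JsB12CombShSym_border_affine (hLc : Odd Lc) (N : ℕ) (tabs : SymTables 3 Lc) (cΛ cB : ℝ) (j : ℕ) (μ ν : Fin 4) (z : Fin 4 → ℤ) :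
    TbalOf Lc (JsB12CombShSym hLc N tabs cΛ cB) j μ ν z =
      TbalOf Lc (JsB12CombShSym hLc N tabs cΛ 0) j μ ν z + cB * (TbalOf Lc (JsB12CombShSym hLc N tabs cΛ 1) j μ ν z - TbalOf Lc (JsB12CombShSym hLc N tabs cΛ 0) j μ ν z) := by
  have h1 : (1 : ℕ) ≤ Lc := Nat.one_le_iff_ne_zero.mpr (NeZero.ne Lc)
  obtain ⟨δK, CK, hδK, -, hK⟩ := decays_GcombSh (d := 3) Lc j
  have hGs : Spr (GcombSh (d := 3) Lc j) := ⟨CK, δK, hδK, hK⟩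
  -- `Loc` of the W-slices of the three members
  have hLoc : ∀ cB'' : ℝ, Loc ((JsB12CombSh0 hLc N tabs cΛ cB'' j).W μ 0 ν z) := fun cB'' => by
    obtain ⟨Cw, δw, hδw, hW⟩ := vertexFamily₂_WcombOf tabs ((Lc : ℝ) ^ 4) (-((Lc : ℝ) ^ 8 / 2)) cΛ ((Lc : ℝ) ^ 8) cB'' ((8 * (N : ℝ) ^ 2)⁻¹ • WilsonVertex2Sym.wsym22 N) j
    rw [JsB12CombSh0_eq, JsComb0Of_W]
    exact ⟨_, _, _, _, hδw, hW μ 0 ν z⟩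
  -- the first-order data do not see `cB`
  have hS : ∀ cB'' : ℝ, (JsB12CombSh0 hLc N tabs cΛ cB'' j).S = (JsB12CombSh0 hLc N tabs cΛ 0 j).S := fun cB'' => by
    rw [JsB12CombSh0_eq, JsB12CombSh0_eq, JsComb0Of_S, JsComb0Of_S]
  have hd : ∀ cB'' : ℝ, TbalOf Lc (JsB12CombShSym hLc N tabs cΛ cB'') j μ ν z - TbalOf Lc (JsB12CombShSym hLc N tabs cΛ 0) j μ ν z =
      (1 / 2) * tadpole (GcombSh (d := 3) Lc j) ((JsB12CombSh0 hLc N tabs cΛ cB'' j).W μ 0 ν z - (JsB12CombSh0 hLc N tabs cΛ 0 j).W μ 0 ν z) := fun cB'' => by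
    rw [TbalOf_JsB12CombShSym, TbalOf_JsB12CombShSym, hS cB'']
    exact hessKer_sub_W hGs _ μ ν z (hLoc cB'') (hLoc 0)
  have hWaff : (JsB12CombSh0 hLc N tabs cΛ cB j).W μ 0 ν z - (JsB12CombSh0 hLc N tabs cΛ 0 j).W μ 0 ν z =
      cB • ((JsB12CombSh0 hLc N tabs cΛ 1 j).W μ 0 ν z - (JsB12CombSh0 hLc N tabs cΛ 0 j).W μ 0 ν z) := by
    simp only [JsB12CombSh0_eq, JsComb0Of_W, WcombOf_eq]
    exact WrecOf_border_affine ((Lc : ℝ) ^ 8) ((8 * (N : ℝ) ^ 2)⁻¹ • WilsonVertex2Sym.wsym22 N) h1 (decays_GcombSh (d := 3) Lc)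
      (locStencil_SpureCombOf tabs ((Lc : ℝ) ^ 4) (-((Lc : ℝ) ^ 8 / 2)) cΛ) tabs.hM tabs.hB tabs.hmix cB j μ 0 ν z
  have e := hd cB
  have e1 := hd 1
  rw [hWaff, KernelReflection.tadpole_smul] at e
  rw [e1]
  linarith

/-- [folklore] The same for the FLIPPED kernels of the END's convention. -/
theorem flipK_TbalOf_JsB12CombShSym_border_affine (hLc : Odd Lc) (N : ℕ) (tabs : SymTables 3 Lc) (cΛ cB : ℝ) (j : ℕ) (μ ν : Fin 4) (z : Fin 4 → ℤ) :
    flipK (TbalOf Lc (JsB12CombShSym hLc N tabs cΛ cB) j) μ ν z =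
      flipK (TbalOf Lc (JsB12CombShSym hLc N tabs cΛ 0) j) μ ν z +
        cB * (fun a b w => flipK (TbalOf Lc (JsB12CombShSym hLc N tabs cΛ 1) j) a b w - flipK (TbalOf Lc (JsB12CombShSym hLc N tabs cΛ 0) j) a b w) μ ν z := by
  simp only [OneStepKernelFamily.flipK_apply]
  exact TbalOf_JsB12CombShSym_border_affine hLc N tabs cΛ cB j μ ν (-z)

/-- [folklore] Summable moments of the record family's UNIT BORDER TOWER `flipK T_j(1) − flipK T_j(0)`. -/
theorem momentSummable_record_unitBorder (hLc : Odd Lc) (N : ℕ) (tabs : SymTables 3 Lc) (cΛ : ℝ) (j n : ℕ) :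
    MomentSummable (fun a b w => flipK (TbalOf Lc (JsB12CombShSym hLc N tabs cΛ 1) j) a b w - flipK (TbalOf Lc (JsB12CombShSym hLc N tabs cΛ 0) j) a b w) n := by
  intro a b
  have h := ((momentSummable_flipK_TbalOf (JsB12CombShSym hLc N tabs cΛ 1) j n) a b).add ((momentSummable_flipK_TbalOf (JsB12CombShSym hLc N tabs cΛ 0) j n) a b)
  refine Summable.of_nonneg_of_le (fun w => mul_nonneg (abs_nonneg _) (pow_nonneg (PolarizationSign.size_pos w).le _)) (fun w => ?_) h
  rw [← add_mul]
  exact mul_le_mul_of_nonneg_right (abs_sub _ _) (pow_nonneg (PolarizationSign.size_pos w).le _)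

/-- [folklore] **EVERY ZEROTH MOMENT OF THE RECORD FAMILY IS AFFINE IN THE BORDER WEIGHT.** -/
theorem zerothMoment_flipK_TbalOf_JsB12CombShSym_border_affine (hLc : Odd Lc) (N : ℕ) (tabs : SymTables 3 Lc) (cΛ cB : ℝ) (j : ℕ) (c e : Fin 4) :
    zerothMoment (flipK (TbalOf Lc (JsB12CombShSym hLc N tabs cΛ cB) j)) c e =
      zerothMoment (flipK (TbalOf Lc (JsB12CombShSym hLc N tabs cΛ 0) j)) c e +
        cB * zerothMoment (fun a b w => flipK (TbalOf Lc (JsB12CombShSym hLc N tabs cΛ 1) j) a b w - flipK (TbalOf Lc (JsB12CombShSym hLc N tabs cΛ 0) j) a b w) c e :=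
  zerothMoment_affine (momentSummable_flipK_TbalOf _ j 3) (momentSummable_record_unitBorder hLc N tabs cΛ j 3) cB
    (fun a b w => flipK_TbalOf_JsB12CombShSym_border_affine hLc N tabs cΛ cB j a b w) c e

/-- [folklore] **EVERY FIRST MOMENT OF THE RECORD FAMILY IS AFFINE IN THE BORDER WEIGHT.** -/
theorem firstMoment_flipK_TbalOf_JsB12CombShSym_border_affine (hLc : Odd Lc) (N : ℕ) (tabs : SymTables 3 Lc) (cΛ cB : ℝ) (j : ℕ) (c e γ : Fin 4) :
    firstMoment (flipK (TbalOf Lc (JsB12CombShSym hLc N tabs cΛ cB) j)) c e γ =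
      firstMoment (flipK (TbalOf Lc (JsB12CombShSym hLc N tabs cΛ 0) j)) c e γ +
        cB * firstMoment (fun a b w => flipK (TbalOf Lc (JsB12CombShSym hLc N tabs cΛ 1) j) a b w - flipK (TbalOf Lc (JsB12CombShSym hLc N tabs cΛ 0) j) a b w) c e γ :=
  firstMoment_affine (momentSummable_flipK_TbalOf _ j 3) (momentSummable_record_unitBorder hLc N tabs cΛ j 3) cB
    (fun a b w => flipK_TbalOf_JsB12CombShSym_border_affine hLc N tabs cΛ cB j a b w) c e γ

/-! ## §3 At the literal of record: the Ward binder (and the reflection binder) pin the border weight -/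

/-- [folklore] Under `hW` at level `j` for the record-family member `cB`: `m₀(flipK T_j(0); c,e) + cB·m₀(unit border_j; c,e) = 0` in every channel. -/
theorem record_borderWeight_eq_of_ward (hLc : Odd Lc) (N : ℕ) (tabs : SymTables 3 Lc) (cΛ cB : ℝ) (j : ℕ)
    (hW : WardTransversal (flipK (TbalOf Lc (JsB12CombShSym hLc N tabs cΛ cB) j))) (c e : Fin 4) :
    zerothMoment (flipK (TbalOf Lc (JsB12CombShSym hLc N tabs cΛ 0) j)) c e +
        cB * zerothMoment (fun a b w => flipK (TbalOf Lc (JsB12CombShSym hLc N tabs cΛ 1) j) a b w - flipK (TbalOf Lc (JsB12CombShSym hLc N tabs cΛ 0) j) a b w) c e = 0 := by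
  rw [← zerothMoment_flipK_TbalOf_JsB12CombShSym_border_affine]
  exact tsum_eq_zero_of_ward (momentSummable_flipK_TbalOf _ j 3) hW c e

/-- [folklore] **WARD PINS THE BORDER WEIGHT OF THE LITERAL OF RECORD**: if at level `j` the record family's unit border tower has a nonzero zeroth moment in some channel, AT MOST ONE `cB`
(per table record, numeral, `cΛ`) admits `hW` at level `j`.  By value (RESULT-1 of this seat, zero weight, p = 3 torus, level 0, Lc = 3) `hW♭` holds at the record's `cB = −Lc¹²∕4`: IF the
unit-border zeroth moment is nonzero there, `−Lc¹²∕4` is THE Ward-compatible border weight at level 0 — a consistency statement about an2's choice, not a number computed here. -/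
theorem record_borderWeight_unique_of_ward (hLc : Odd Lc) (N : ℕ) (tabs : SymTables 3 Lc) (cΛ cB cB' : ℝ) (j : ℕ) {c e : Fin 4}
    (hU : zerothMoment (fun a b w => flipK (TbalOf Lc (JsB12CombShSym hLc N tabs cΛ 1) j) a b w - flipK (TbalOf Lc (JsB12CombShSym hLc N tabs cΛ 0) j) a b w) c e ≠ 0)
    (hW : WardTransversal (flipK (TbalOf Lc (JsB12CombShSym hLc N tabs cΛ cB) j))) (hW' : WardTransversal (flipK (TbalOf Lc (JsB12CombShSym hLc N tabs cΛ cB') j))) :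
    cB = cB' := by
  by_contra hne
  exact hU (eq_zero_of_affine_pair (record_borderWeight_eq_of_ward hLc N tabs cΛ cB j hW c e) (record_borderWeight_eq_of_ward hLc N tabs cΛ cB' j hW' c e) hne).1

/-- [folklore] … with the explicit value `cB = −m₀(flipK T_j(0); c,e) ∕ m₀(unit border_j; c,e)`. -/
theorem record_borderWeight_formula_of_ward (hLc : Odd Lc) (N : ℕ) (tabs : SymTables 3 Lc) (cΛ cB : ℝ) (j : ℕ) {c e : Fin 4}
    (hU : zerothMoment (fun a b w => flipK (TbalOf Lc (JsB12CombShSym hLc N tabs cΛ 1) j) a b w - flipK (TbalOf Lc (JsB12CombShSym hLc N tabs cΛ 0) j) a b w) c e ≠ 0)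
    (hW : WardTransversal (flipK (TbalOf Lc (JsB12CombShSym hLc N tabs cΛ cB) j))) :
    cB = -(zerothMoment (flipK (TbalOf Lc (JsB12CombShSym hLc N tabs cΛ 0) j)) c e) /
      zerothMoment (fun a b w => flipK (TbalOf Lc (JsB12CombShSym hLc N tabs cΛ 1) j) a b w - flipK (TbalOf Lc (JsB12CombShSym hLc N tabs cΛ 0) j) a b w) c e := by
  have h := record_borderWeight_eq_of_ward hLc N tabs cΛ cB j hW c e
  field_simp
  linarith

/-- [folklore] **REFLECTION PINS THE BORDER WEIGHT OF THE LITERAL OF RECORD**: a NONZERO first moment of the record family's unit border tower at level `j` in some `(c,e,γ)` leaves AT MOST ONE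
`hR`-compatible border weight at that level (an1's `firstMoment_eq_zero_of_reflectionCovariant` + the affinity). -/
theorem record_borderWeight_unique_of_hR (hLc : Odd Lc) (N : ℕ) (tabs : SymTables 3 Lc) (cΛ cB cB' : ℝ) (j : ℕ) {c e γ : Fin 4}
    (hU : firstMoment (fun a b w => flipK (TbalOf Lc (JsB12CombShSym hLc N tabs cΛ 1) j) a b w - flipK (TbalOf Lc (JsB12CombShSym hLc N tabs cΛ 0) j) a b w) c e γ ≠ 0)
    (hR : AxisReflectionCovariant (flipK (TbalOf Lc (JsB12CombShSym hLc N tabs cΛ cB) j)))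
    (hR' : AxisReflectionCovariant (flipK (TbalOf Lc (JsB12CombShSym hLc N tabs cΛ cB') j))) : cB = cB' := by
  have h0 : ∀ cB'' : ℝ, AxisReflectionCovariant (flipK (TbalOf Lc (JsB12CombShSym hLc N tabs cΛ cB'') j)) →
      firstMoment (flipK (TbalOf Lc (JsB12CombShSym hLc N tabs cΛ 0) j)) c e γ +
        cB'' * firstMoment (fun a b w => flipK (TbalOf Lc (JsB12CombShSym hLc N tabs cΛ 1) j) a b w - flipK (TbalOf Lc (JsB12CombShSym hLc N tabs cΛ 0) j) a b w) c e γ = 0 :=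
    fun cB'' h => by rw [← firstMoment_flipK_TbalOf_JsB12CombShSym_border_affine]; exact firstMoment_eq_zero_of_reflectionCovariant h c e γ
  by_contra hne
  exact hU (eq_zero_of_affine_pair (h0 cB hR) (h0 cB' hR') hne).1

end Record


end Summit.QuantumFields.BalabanUV.Gaps.D1RecordWardPinsBorderWeight

end
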